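import Literature.Topology.FourManifolds.ConcordanceEndSplice
import HarnessLib

/-!
# Splicing the trace of an ambient isotopy into the upper cone of a conical concordance

Topic `Literature/Topology/FourManifolds`; the mirror image of `ConcordanceEndSplice.lean` at the
outer end (preparatory step of the proof programme of the Fox–Milnor fact
`Literature.Topology.FourManifolds.Knot.exists_isConnectedSum_isConcordant`). Everything here is
proved; no named fact is introduced.

Given a conical concordance `f` from `K` to `K'` and an ambient isotopy `F` of `𝕊³`, the upper
cone `t • K' x`, `t ≥ 2 - ε`, is replaced by the trace `t • F_{λ(t)} (K' x)` (`λ = 1` for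
`t ≥ 2 - ε/2`, `λ = 0` for `t ≤ 2 - ε`), `ε ≤ δ/2` below the upper margin of the middle levels:
the result is a conical concordance of width `ε/2` from `K` to the moved knot
`K'.map (F.toDiffeomorph 1)` (`IsConicalConcordance.exists_splice_top`).

## References

* R. H. Fox, J. W. Milnor, *Singularities of 2-spheres in 4-space and cobordism of knots*, Osaka
  J. Math. 3 (1966), §1. [FoxMilnor1966]
* M. W. Hirsch, *Differential Topology*, GTM 33 (1976), Ch. 8 §1. [HirschDT1976]

## Design notes

No named facts, no `sorry`; `𝔼 n`, `𝕊 n`, `𝓘₁₁` are local notation as in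
`ConcordanceStripReplacement.lean`.
-/

open scoped Manifold Topology ContDiff RealInnerProductSpace
open Function Set Metric Filter

noncomputable section

namespace Literature.Topology.FourManifolds

/-- Local notation: `𝔼 n` is the model Euclidean space `EuclideanSpace ℝ (Fin n)`. -/
local notation "𝔼 " n:arg => EuclideanSpace ℝ (Fin n)

/-- Local notation: `𝕊 n` is the unit sphere in `EuclideanSpace ℝ (Fin (n + 1))`. -/
local notation "𝕊 " n:arg => (Metric.sphere (0 : EuclideanSpace ℝ (Fin (n + 1))) 1)

/-- Local notation for the model with corners of `𝕊 1 × ℝ`. -/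
local notation "𝓘₁₁" => (ModelWithCorners.prod (𝓡 1) 𝓘(ℝ, ℝ))

attribute [local instance] fact_finrank_euclideanSpace_succ

namespace Knot

open StripFrame

/-! ### The transition function at the outer end -/

/-- The transition `μ_ε t = smoothTransition ((t - (2 - ε)) / (ε/2))`: `1` for `t ≥ 2 - ε/2`,
`0` for `t ≤ 2 - ε`. [folklore] -/
def spliceFnTop (ε t : ℝ) : ℝ := Real.smoothTransition ((t - (2 - ε)) / (ε / 2))

/-- The transition is `C^∞` in `t`. [folklore] -/
theorem contDiff_spliceFnTop (ε : ℝ) : ContDiff ℝ ∞ (spliceFnTop ε) :=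
  Real.smoothTransition.contDiff.comp ((contDiff_id.sub contDiff_const).div_const _)

/-- `μ_ε t = 1` for `t ≥ 2 - ε/2` (`ε > 0`). [folklore] -/
theorem spliceFnTop_of_ge {ε t : ℝ} (hε : 0 < ε) (ht : 2 - ε / 2 ≤ t) : spliceFnTop ε t = 1 := by
  rw [spliceFnTop, Real.smoothTransition.one_of_one_le]
  rw [le_div_iff₀ (by positivity)]; linarith

/-- `μ_ε t = 0` for `t ≤ 2 - ε` (`ε > 0`). [folklore] -/
theorem spliceFnTop_of_le {ε t : ℝ} (hε : 0 < ε) (ht : t ≤ 2 - ε) : spliceFnTop ε t = 0 := by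
  rw [spliceFnTop, Real.smoothTransition.zero_of_nonpos]
  exact div_nonpos_of_nonpos_of_nonneg (by linarith) (by positivity)

namespace IsConicalConcordance

variable {K K' : Knot} {f : (𝕊 1) × ℝ → 𝔼 4} {δ : ℝ} (h : IsConicalConcordance K K' f δ)
include h

/-! ### The upper margin of the middle levels -/

/-- **The upper margin of the middle**: on `[1 + δ, 2 - δ]` the radius is at most `2 - m` for
some `m > 0` (compactness). [folklore] -/
theorem exists_upper_margin : ∃ m : ℝ, 0 < m ∧ ∀ θ, ∀ t ∈ Icc (1 + δ) (2 - δ),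
    ‖annulusLift f (θ, t)‖ ≤ 2 - m := by
  have hδ := h.δ_pos
  have hδ4 := h.δ_le
  have hKc : IsCompact (Icc (0 : ℝ) 1 ×ˢ Icc (1 + δ) (2 - δ)) := isCompact_Icc.prod isCompact_Icc
  have hne : (Icc (0 : ℝ) 1 ×ˢ Icc (1 + δ) (2 - δ)).Nonempty :=
    ⟨(0, 3 / 2), ⟨⟨le_rfl, zero_le_one⟩, ⟨by linarith, by linarith⟩⟩⟩
  have hc : Continuous fun p : ℝ × ℝ ↦ -‖annulusLift f p‖ :=
    (contDiff_annulusLift h.isConcordance.1).continuous.norm.neg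
  obtain ⟨p₁, hp₁, hmin⟩ := hKc.exists_isMinOn hne hc.continuousOn
  rw [isMinOn_iff] at hmin
  have hp₁' := mem_prod.1 hp₁
  have h1 : ‖annulusLift f p₁‖ < 2 := by
    rw [show p₁ = (p₁.1, p₁.2) from rfl, annulusLift_apply]
    exact (h.isConcordance.2.2.2.1 _ _ ⟨by linarith [hp₁'.2.1], by linarith [hp₁'.2.2]⟩).2
  refine ⟨2 - ‖annulusLift f p₁‖, by linarith, fun θ t ht ↦ ?_⟩
  have hper : annulusLift f (θ, t) = annulusLift f (Int.fract θ, t) := by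
    have := annulusLift_add_int f (Int.fract θ) t ⌊θ⌋
    rw [show Int.fract θ + (⌊θ⌋ : ℝ) = θ from Int.fract_add_floor θ] at this
    exact this
  rw [hper]
  have := hmin (Int.fract θ, t) (mem_prod.2 ⟨⟨Int.fract_nonneg θ, (Int.fract_lt_one θ).le⟩, ht⟩)
  linarith

/-! ### The spliced lift at the outer end -/

variable (F : AmbientIsotopy (𝓡 3) (𝕊 3))

/-- The moving unit curve `P (θ, t) = F_{μ_ε t} (K' (circlePt θ))` read in `ℝ⁴`. [folklore] -/
def movingCurveTop (_ : IsConicalConcordance K K' f δ) (ε : ℝ) (q : ℝ × ℝ) : 𝔼 4 :=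
  ((F.toFun (spliceFnTop ε q.2) (K' (circlePt q.1)) : 𝕊 3) : 𝔼 4)

/-- The moving curve is `C^∞`. [folklore] -/
theorem contDiff_movingCurveTop (ε : ℝ) : ContDiff ℝ ∞ (h.movingCurveTop F ε) := by
  have h1 : ContMDiff (𝓘(ℝ, ℝ).prod 𝓘(ℝ, ℝ)) (𝓡 3) ∞
      fun q : ℝ × ℝ ↦ F.toFun (spliceFnTop ε q.2) (K' (circlePt q.1)) :=
    F.contMDiff.comp (((contDiff_spliceFnTop ε).contMDiff.comp contMDiff_snd).prodMk
      ((K'.contMDiff.comp contMDiff_circlePt).comp contMDiff_fst))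
  have h2 : ContMDiff (𝓘(ℝ, ℝ).prod 𝓘(ℝ, ℝ)) 𝓘(ℝ, 𝔼 4) ∞ (h.movingCurveTop F ε) :=
    contMDiff_coe_sphere.comp h1
  rw [← contMDiff_iff_contDiff]
  rw [modelWithCornersSelf_prod, ← chartedSpaceSelf_prod]
  exact h2

/-- The moving curve is a unit curve. [folklore] -/
theorem norm_movingCurveTop (ε : ℝ) (q : ℝ × ℝ) : ‖h.movingCurveTop F ε q‖ = 1 := norm_eq_of_mem_sphere _

/-- The `θ`-derivative of the moving curve does not vanish. [folklore] -/
theorem fderiv_movingCurveTop_ne_zero (ε : ℝ) (q : ℝ × ℝ) :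
    fderiv ℝ (h.movingCurveTop F ε) q (1, 0) ≠ 0 := by
  have hd : fderiv ℝ (h.movingCurveTop F ε) q (1, 0) =
      deriv (Knot.curve (K'.map (F.toDiffeomorph (spliceFnTop ε q.2)))) q.1 := by
    have hc : HasDerivAt (fun θ : ℝ ↦ (θ, q.2)) ((1, 0) : ℝ × ℝ) q.1 :=
      (hasDerivAt_id q.1).prodMk (hasDerivAt_const q.1 q.2)
    have := (((h.contDiff_movingCurveTop F ε).differentiable (by simp)) q).hasFDerivAt.comp_hasDerivAt
      q.1 hc
    have hfun : (h.movingCurveTop F ε ∘ fun θ : ℝ ↦ (θ, q.2)) =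
        Knot.curve (K'.map (F.toDiffeomorph (spliceFnTop ε q.2))) := rfl
    rw [hfun] at this
    exact this.deriv.symm
  rw [hd]
  exact Knot.deriv_curve_ne_zero _ _

/-- The moving curve is periodic in `θ`. [folklore] -/
theorem movingCurveTop_add_one (ε θ t : ℝ) :
    h.movingCurveTop F ε (θ + 1, t) = h.movingCurveTop F ε (θ, t) := by
  simp [movingCurveTop, circlePt_add_one]

/-- **The spliced lift at the outer end**: the trace cone `t • F_{μ_ε t} (K' x)` for `t ≥ 2 - ε`,
the old annulus below. [folklore] -/
def spliceLiftTop (ε : ℝ) (q : ℝ × ℝ) : 𝔼 4 :=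
  if 2 - ε ≤ q.2 then q.2 • h.movingCurveTop F ε q else annulusLift f q

/-- The trace part. [folklore] -/
theorem spliceLiftTop_of_ge {ε : ℝ} {q : ℝ × ℝ} (hq : 2 - ε ≤ q.2) :
    h.spliceLiftTop F ε q = q.2 • h.movingCurveTop F ε q := if_pos hq

/-- The old part. [folklore] -/
theorem spliceLiftTop_of_lt {ε : ℝ} {q : ℝ × ℝ} (hq : q.2 < 2 - ε) :
    h.spliceLiftTop F ε q = annulusLift f q := if_neg (not_le.2 hq)

/-- Above `2 - δ` the spliced lift is the trace cone, for `0 < ε`. [folklore] -/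
theorem spliceLiftTop_of_ge_delta {ε : ℝ} (hε : 0 < ε) {q : ℝ × ℝ} (hq : 2 - δ ≤ q.2) :
    h.spliceLiftTop F ε q = q.2 • h.movingCurveTop F ε q := by
  rcases le_or_gt (2 - ε) q.2 with h1 | h1
  · exact h.spliceLiftTop_of_ge F h1
  · rw [h.spliceLiftTop_of_lt F h1, show q = (q.1, q.2) from rfl, annulusLift_apply, h.cone₂ _ _ hq,
      movingCurveTop, spliceFnTop_of_le hε h1.le, F.map_zero]
    rfl

/-- The spliced lift is `1`-periodic in `θ`. [folklore] -/
theorem spliceLiftTop_add_one (ε θ t : ℝ) :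
    h.spliceLiftTop F ε (θ + 1, t) = h.spliceLiftTop F ε (θ, t) := by
  by_cases ht : 2 - ε ≤ t
  · rw [h.spliceLiftTop_of_ge F (q := (θ + 1, t)) ht, h.spliceLiftTop_of_ge F (q := (θ, t)) ht,
      h.movingCurveTop_add_one]
  · push Not at ht
    rw [h.spliceLiftTop_of_lt F (q := (θ + 1, t)) ht, h.spliceLiftTop_of_lt F (q := (θ, t)) ht]
    exact_mod_cast annulusLift_add_int f θ t 1

/-- **The spliced lift is `C^∞`** (for `0 < ε < δ`). [folklore] -/
theorem contDiff_spliceLiftTop {ε : ℝ} (hε : 0 < ε) (hεδ : ε < δ) : ContDiff ℝ ∞ (h.spliceLiftTop F ε) := by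
  have hb : ContDiff ℝ ∞ fun q : ℝ × ℝ ↦ q.2 • h.movingCurveTop F ε q :=
    contDiff_snd.smul (h.contDiff_movingCurveTop F ε)
  have hl : ContDiff ℝ ∞ (annulusLift f) := contDiff_annulusLift h.isConcordance.1
  rw [contDiff_iff_contDiffAt]
  intro q
  rcases lt_or_ge (2 - δ) q.2 with h1 | h1
  · refine hb.contDiffAt.congr_of_eventuallyEq ?_
    filter_upwards [(isOpen_lt continuous_const continuous_snd).mem_nhds h1] with q' hq'
    exact h.spliceLiftTop_of_ge_delta F hε (le_of_lt hq')
  · refine hl.contDiffAt.congr_of_eventuallyEq ?_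
    filter_upwards [(isOpen_lt continuous_snd continuous_const).mem_nhds
      (show q.2 < 2 - ε by linarith)] with q' hq'
    exact h.spliceLiftTop_of_lt F hq'

/-- The radius of the trace part is the parameter. [folklore] -/
theorem norm_spliceLiftTop_of_ge {ε : ℝ} {q : ℝ × ℝ} (hq : 2 - ε ≤ q.2) (hq0 : 0 ≤ q.2) :
    ‖h.spliceLiftTop F ε q‖ = q.2 := by
  rw [h.spliceLiftTop_of_ge F hq, norm_smul, h.norm_movingCurveTop, mul_one, Real.norm_eq_abs,
    abs_of_nonneg hq0]

/-- **The radii of the old part below `2 - ε` are less than `2 - ε`** when `0 < ε` is below the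
upper margin. [folklore] -/
theorem norm_annulusLift_lt {ε m : ℝ} (hε : 0 < ε) (hεm : ε < m)
    (hm : ∀ θ, ∀ t ∈ Icc (1 + δ) (2 - δ), ‖annulusLift f (θ, t)‖ ≤ 2 - m)
    {θ t : ℝ} (ht : t < 2 - ε) (ht1 : 1 ≤ t) : ‖annulusLift f (θ, t)‖ < 2 - ε := by
  have hδ := h.δ_pos
  have hδ4 := h.δ_le
  rcases le_or_gt t (1 + δ) with h1 | h1
  · rw [annulusLift_apply, h.cone₁ _ _ h1, norm_smul, norm_eq_of_mem_sphere, mul_one, Real.norm_eq_abs,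
      abs_of_pos (by linarith)]
    linarith
  rcases lt_or_ge t (2 - δ) with h2 | h2
  · have := hm θ t ⟨h1.le, h2.le⟩; linarith
  · rw [annulusLift_apply, h.cone₂ _ _ h2, norm_smul, norm_eq_of_mem_sphere, mul_one, Real.norm_eq_abs,
      abs_of_pos (by linarith)]
    exact ht

/-! ### The spliced concordance at the outer end -/

/-- **Splicing the trace of an ambient isotopy into the upper cone.** For a conical concordance
`f` from `K` to `K'` and an ambient isotopy `F` of `𝕊³` there are `ε > 0` (`ε ≤ δ/2`) and a
conical concordance `f'` of width `ε/2` from `K` to the moved knot `K'.map (F.toDiffeomorph 1)`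
which agrees with `f` below radius `2 - ε` and is the trace cone `t • F_s (K' x)` (some `s`)
above. [folklore] -/
theorem exists_splice_top :
    ∃ (ε : ℝ) (f' : (𝕊 1) × ℝ → 𝔼 4), 0 < ε ∧ ε ≤ δ / 2 ∧
      IsConicalConcordance K (K'.map (F.toDiffeomorph 1)) f' (ε / 2) ∧
      (∀ (x : 𝕊 1) (t : ℝ), t < 2 - ε → f' (x, t) = f (x, t)) ∧
      ∀ (x : 𝕊 1) (t : ℝ), 2 - ε ≤ t → ∃ s : ℝ, f' (x, t) = t • ((F.toFun s (K' x) : 𝕊 3) : 𝔼 4) := by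
  have hδ := h.δ_pos
  have hδ4 := h.δ_le
  obtain ⟨m, hm, hmarg⟩ := h.exists_upper_margin
  set ε : ℝ := min (δ / 2) (m / 2) with hε
  have hεpos : 0 < ε := lt_min (by positivity) (by positivity)
  have hεδ : ε ≤ δ / 2 := min_le_left _ _
  have hεm : ε < m := (min_le_right _ _).trans_lt (by linarith)
  have hεδ' : ε < δ := by linarith
  set G := h.spliceLiftTop F ε with hG
  have hGs : ContDiff ℝ ∞ G := h.contDiff_spliceLiftTop F hεpos hεδ'
  have hper : ∀ θ t, G (θ + 1, t) = G (θ, t) := h.spliceLiftTop_add_one F ε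
  have hval : ∀ u t, descend G (circlePt u, t) = G (u, t) := fun u t ↦ descend_circlePt hper u t
  have hnorm_ge : ∀ u t, 2 - ε ≤ t → ‖G (u, t)‖ = t := fun u t ht ↦
    h.norm_spliceLiftTop_of_ge F (q := (u, t)) ht (by simp only; linarith)
  have hnorm_lt : ∀ u t, t < 2 - ε → 1 ≤ t → ‖G (u, t)‖ < 2 - ε := fun u t ht ht1 ↦ by
    rw [hG, h.spliceLiftTop_of_lt F (q := (u, t)) ht]
    exact h.norm_annulusLift_lt hεpos hεm hmarg ht ht1
  -- injectivity of the lift modulo the period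
  have hinjG : ∀ u t u' t', t ∈ Icc (1 : ℝ) 2 → t' ∈ Icc (1 : ℝ) 2 → G (u, t) = G (u', t') →
      t = t' ∧ ∃ k : ℤ, u' = u + k := by
    intro u t u' t' ht ht' he
    rcases le_or_gt (2 - ε) t with h1 | h1 <;> rcases le_or_gt (2 - ε) t' with h1' | h1'
    · have hn : t = t' := by rw [← hnorm_ge u t h1, ← hnorm_ge u' t' h1', he]
      subst hn
      refine ⟨rfl, ?_⟩
      rw [hG, h.spliceLiftTop_of_ge F (q := (u, t)) h1, h.spliceLiftTop_of_ge F (q := (u', t)) h1] at he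
      have he' : h.movingCurveTop F ε (u, t) = h.movingCurveTop F ε (u', t) :=
        smul_right_injective _ (by simp only; linarith [ht.1]) he
      have he'' : F.toFun (spliceFnTop ε t) (K' (circlePt u)) =
          F.toFun (spliceFnTop ε t) (K' (circlePt u')) := Subtype.ext he'
      have := K'.injective ((F.bijective _).1 he'')
      obtain ⟨k, hk⟩ := circlePt_eq_circlePt_iff.1 this.symm
      exact ⟨k, hk⟩
    · exfalso
      have e1 := hnorm_ge u t h1
      have e2 := hnorm_lt u' t' h1' ht'.1
      rw [← he, e1] at e2; linarith
    · exfalso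
      have e1 := hnorm_ge u' t' h1'
      have e2 := hnorm_lt u t h1 ht.1
      rw [he, e1] at e2; linarith
    · rw [hG, h.spliceLiftTop_of_lt F (q := (u, t)) h1, h.spliceLiftTop_of_lt F (q := (u', t')) h1'] at he
      exact h.exists_int_of_F_eq ht ht' he
  -- injective differential of the lift
  have hderG : ∀ u t, t ∈ Icc (1 : ℝ) 2 → Injective (fderiv ℝ G (u, t)) := by
    intro u t ht
    rcases lt_or_ge (2 - δ) t with h1 | h1
    · have hev : G =ᶠ[𝓝 (u, t)] fun q : ℝ × ℝ ↦ q.2 • h.movingCurveTop F ε q := by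
        filter_upwards [(isOpen_lt continuous_const continuous_snd).mem_nhds (show 2 - δ < (u, t).2 from h1)]
          with q hq
        exact h.spliceLiftTop_of_ge_delta F hεpos (le_of_lt hq)
      rw [hev.fderiv_eq]
      exact injective_fderiv_cone_family ((h.contDiff_movingCurveTop F ε).of_le (by simp))
        (h.norm_movingCurveTop F ε) (h.fderiv_movingCurveTop_ne_zero F ε (u, t))
        (by simp only; linarith [ht.1])
    · have hev : G =ᶠ[𝓝 (u, t)] annulusLift f := by
        filter_upwards [(isOpen_lt continuous_snd continuous_const).mem_nhds
          (show (u, t).2 < 2 - ε by simp only; linarith)] with q hq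
        exact h.spliceLiftTop_of_lt F hq
      rw [hev.fderiv_eq]
      exact h.injective_fderiv_annulusLift u ⟨by linarith [ht.1], by linarith⟩
  refine ⟨ε, descend G, hεpos, hεδ, ?_, ?_, ?_⟩
  · refine
      { isConcordance := ⟨contMDiff_descend hGs hper, ?_, ?_, ?_, ?_, ?_, ?_⟩
        δ_pos := by positivity
        δ_le := by linarith
        cone₁ := fun x t ht ↦ ?_
        cone₂ := fun x t ht ↦ ?_ }
    · -- injectivity on the annulus
      rintro ⟨x, t⟩ ⟨-, ht⟩ ⟨x', t'⟩ ⟨-, ht'⟩ he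
      rw [← circlePt_angA x, ← circlePt_angA x', hval, hval] at he
      obtain ⟨htt, k, hk⟩ := hinjG _ _ _ _ ht ht' he
      have hx : x' = x := by
        rw [← circlePt_angA x', hk]
        exact (circlePt_eq_circlePt_iff.2 ⟨k, rfl⟩).trans (circlePt_angA x)
      simp only at htt
      subst htt
      rw [hx]
    · -- immersion on the annulus
      rintro ⟨x, t⟩ ⟨-, ht⟩
      exact mfderiv_descend_injective hGs hper fun u _ ↦ hderG u t ht
    · -- the open annulus goes into the open shell
      intro x t ht
      rw [← circlePt_angA x, hval]
      rcases le_or_gt (2 - ε) t with h1 | h1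
      · rw [hnorm_ge _ t h1]
        exact ⟨by linarith, ht.2⟩
      · rw [hG, h.spliceLiftTop_of_lt F (q := (angA x, t)) h1, annulusLift_apply, circlePt_angA]
        exact h.isConcordance.2.2.2.1 x t ht
    · -- neatness
      intro x
      constructor
      · have hev : (fun t ↦ ‖descend G (x, t)‖ ^ 2) =ᶠ[𝓝 1] fun t ↦ ‖f (x, t)‖ ^ 2 := by
          filter_upwards [Iio_mem_nhds (by linarith : (1 : ℝ) < 2 - ε)] with t ht
          rw [← circlePt_angA x, hval, hG, h.spliceLiftTop_of_lt F (q := (angA x, t)) ht, annulusLift_apply,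
            circlePt_angA]
        rw [hev.deriv_eq]
        exact (h.isConcordance.2.2.2.2.1 x).1
      · have hev : (fun t ↦ ‖descend G (x, t)‖ ^ 2) =ᶠ[𝓝 2] fun t ↦ t ^ 2 := by
          filter_upwards [Ioi_mem_nhds (by linarith : (2 : ℝ) - ε < 2)] with t ht
          rw [← circlePt_angA x, hval, hnorm_ge _ t (le_of_lt ht)]
        rw [hev.deriv_eq]
        norm_num
    · -- the inner end
      intro x
      rw [← circlePt_angA x, hval, hG, h.spliceLiftTop_of_lt F (q := (angA x, 1)) (by simp only; linarith),
        annulusLift_apply, circlePt_angA]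
      exact h.isConcordance.2.2.2.2.2.1 x
    · -- the outer end is the moved knot
      intro x
      rw [← circlePt_angA x, hval, hG, h.spliceLiftTop_of_ge F (q := (angA x, 2)) (by simp only; linarith),
        movingCurveTop, spliceFnTop_of_ge hεpos (by simp only; linarith), circlePt_angA]
      rfl
    · -- the lower cone is the old one
      rw [← circlePt_angA x, hval, hG, h.spliceLiftTop_of_lt F (q := (angA x, t)) (by simp only; linarith),
        annulusLift_apply, circlePt_angA]
      exact h.cone₁ x t (by linarith)
    · -- the new upper cone
      rw [← circlePt_angA x, hval, hG, h.spliceLiftTop_of_ge F (q := (angA x, t)) (by simp only; linarith),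
        movingCurveTop, spliceFnTop_of_ge hεpos (by simp only; linarith), circlePt_angA]
      rfl
  · intro x t ht
    rw [← circlePt_angA x, hval, hG, h.spliceLiftTop_of_lt F (q := (angA x, t)) ht, annulusLift_apply,
      circlePt_angA]
  · intro x t ht
    refine ⟨spliceFnTop ε t, ?_⟩
    rw [← circlePt_angA x, hval, hG, h.spliceLiftTop_of_ge F (q := (angA x, t)) ht, movingCurveTop, circlePt_angA]

end IsConicalConcordance

end Knot

end Literature.Topology.FourManifolds
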